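import Literature.Computability.AlgebraicComplexity.GrenetAdjCells

/-! # Crux `UniqStep` (stmt-ValiantsHypothesis-17834), line `Sketch` (phase 2: the purified source twist) — stub `stub_cells_other`:
# the generic rows of the purified matrix are honest and free of `X (0, 0)`

WHAT. Let `n = k + 3`, `R := MvPolynomial (Fin n × Fin n) ℂ`, and index rows and columns by
`Finset (Fin n)` (the vertices of Grenet's hypercube; the arc `S → insert j S`, `j ∉ S`, of Grenet's
adjacency matrix `adj := Grenet.adj ℂ n` carries `X (j, |S|)`). The purified source twist of
Grenet's matrix is `K_full := P · (1 − adj) · EQ`, where `P` and `EQ` are explicit products of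
elementary matrices, entering here only through their ROW ACTION
`(P M) S = −M ∅ + M {0,1}` at `S = ∅`, `M {0} + M {1,2}` at `{0}`, `−M ∅ + M {1} + M {0,2}` at `{1}`,
`M S + M {0,1}` at the other singletons, `M S` elsewhere, and COLUMN ACTION
`(M EQ) · T = M·{1,2} − X(1,0) M·{0} + X(0,0) M·{1} − M·{0}` at `T = {1,2}`, `−M·{1} + M·{0,2}` at
`{1}`, `−M·T` at the other singletons, `M·T` elsewhere. This file proves (`stub_cells_other`): in
every row `S ∉ {univ, ∅, {0}, {1}}` and every column `T ≠ ∅` the cell `K_full S T` is `−X v` or a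
constant, and the variable `X (0, 0)` does not occur in it. Indeed such a row of `P · (1 − adj)` is
the row `S` of `1 − adj` (plus the row `{0,1}` when `S = {l}`, `l ≥ 2`), the column operations only
ever add multiples of cells that vanish in these rows, and every surviving cell is `± [S = T]` or
`−adj S' T` with `S' ≠ ∅` — whose variables have level `|S'| ≥ 1`, never `(0, 0)`
(`Literature/…/GrenetAdjCells.lean`: `Grenet.adj_apply_of_card_ne`, `Grenet.coeff_adj_apply_of_ne`).

WHY. Stub V3b of the line: with V3a (the rows `∅, {0}, {1}`, where `X (0,0)` occurs exactly three
times) it shows that the signed `(univ, ∅)`-minor of `K_full` is an HONEST projection whose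
`X (0,0)`-coefficient matrix has rank `2`; Grenet's coefficient matrices never have rank `2`, so the two
optimal projections are inequivalent and the antecedent `Uniq n` of the crux `UniqStep` fails.

SOURCE. This session's construction (computations `compute/purify_*.py`); the matrix being purified is
that of B. Grenet, *An upper bound for the permanent versus determinant problem* (2011), Thm. 1, and the
`(3,7)` twist is from J. Hüttenhain, C. Ikenmeyer, *Binary determinantal complexity*, Linear Algebra
Appl. 504 (2016). The computation here is elementary.
-/

-- D-0017 layout: Sub = Summit for this single-conjunct summit, so the namespace repeats a component.
set_option linter.dupNamespace false

namespace Summit.ValiantsHypothesis.ValiantsHypothesis.Theorems.ProjectionStabilityUniqStep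

open MvPolynomial
open scoped BigOperators Matrix
open Literature.Computability.AlgebraicComplexity

noncomputable section

/-! ### The two honest-cell shapes -/

/-- A constant cell `C c` is honest and free of `X (0, 0)`. [folklore] -/
theorem isPure_and_coeff_zero_of_eq_C {k : ℕ} {x : MvPolynomial (Fin (k + 3) × Fin (k + 3)) ℂ}
    (c : ℂ) (hx : x = C c) :
    ((∃ v, x = -X v) ∨ ∃ c, x = C c) ∧
      MvPolynomial.coeff (Finsupp.single ((0 : Fin (k + 3)), (0 : Fin (k + 3))) 1) x = 0 := by
  subst hx
  refine ⟨Or.inr ⟨c, rfl⟩, ?_⟩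
  rw [coeff_C, if_neg]
  exact fun h => (Finsupp.single_ne_zero.mpr one_ne_zero) h.symm

/-- A cell `−adj S T` of minus Grenet's adjacency matrix in a row `S ≠ ∅` is honest (`−X v` or `0`)
and free of `X (0, 0)`: its variables have level `|S| ≠ 0`. [folklore] -/
theorem isPure_and_coeff_zero_of_eq_neg_adj {k : ℕ}
    {x : MvPolynomial (Fin (k + 3) × Fin (k + 3)) ℂ} {S : Finset (Fin (k + 3))}
    (T : Finset (Fin (k + 3))) (hS : S ≠ ∅) (hx : x = -Grenet.adj ℂ (k + 3) S T) :
    ((∃ v, x = -X v) ∨ ∃ c, x = C c) ∧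
      MvPolynomial.coeff (Finsupp.single ((0 : Fin (k + 3)), (0 : Fin (k + 3))) 1) x = 0 := by
  subst hx
  refine ⟨Grenet.neg_adj_apply_isPure ℂ S T, ?_⟩
  rw [coeff_neg, Grenet.coeff_adj_apply_of_ne ℂ S T, neg_zero]
  rw [Fin.val_zero]
  exact fun h => hS (Finset.card_eq_zero.mp h.symm)

/-- Off-diagonal cells of `1 − adj`: `(1 − adj) S T = −adj S T` for `S ≠ T`. [folklore] -/
theorem one_sub_adj_apply_of_ne {k : ℕ} {S T : Finset (Fin (k + 3))} (h : S ≠ T) :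
    (1 - Grenet.adj ℂ (k + 3)) S T = -Grenet.adj ℂ (k + 3) S T := by
  rw [Grenet.one_sub_adj_apply, if_neg h, zero_sub]

/-- Off-diagonal, off-level cells of `1 − adj` vanish: `(1 − adj) S T = 0` for `|T| ≠ |S| + 1`,
`S ≠ T`. [folklore] -/
theorem one_sub_adj_apply_of_card_ne {k : ℕ} {S T : Finset (Fin (k + 3))} (h : S ≠ T)
    (hc : T.card ≠ S.card + 1) : (1 - Grenet.adj ℂ (k + 3)) S T = 0 := by
  rw [one_sub_adj_apply_of_ne h, Grenet.adj_apply_of_card_ne ℂ hc, neg_zero]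

/-- Diagonal cells of `1 − adj`: `(1 − adj) S S = 1`. [folklore] -/
theorem one_sub_adj_apply_self {k : ℕ} (S : Finset (Fin (k + 3))) :
    (1 - Grenet.adj ℂ (k + 3)) S S = 1 := by
  rw [Grenet.one_sub_adj_apply, if_pos rfl, Grenet.adj_apply_self, sub_zero]

/-! ### The stub -/

/-- **STUB V3b** of line `Sketch` (phase 2) of crux `UniqStep`: in every row
`S ∉ {univ, ∅, {0}, {1}}` and every column `T ≠ ∅` of the purified matrix `P · (1 − adj) · EQ`
(with `P`, `EQ` given by their row and column actions) the cell is `−X v` or a constant, and its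
`X (0, 0)`-coefficient vanishes. [folklore] -/
theorem stub_cells_other :
    ∀ (k : ℕ) (P EQ : Matrix (Finset (Fin (k + 3))) (Finset (Fin (k + 3))) (MvPolynomial (Fin (k + 3) × Fin (k + 3)) ℂ)),
    (∀ (M : Matrix (Finset (Fin (k + 3))) (Finset (Fin (k + 3))) (MvPolynomial (Fin (k + 3) × Fin (k + 3)) ℂ))
        (S T : Finset (Fin (k + 3))),
      (P * M) S T =
        if S = ∅ then -M ∅ T + M {0, 1} T
        else if S = {0} then M {0} T + M {1, 2} T
        else if S = {1} then -M ∅ T + M {1} T + M {0, 2} T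
        else if S.card = 1 then M S T + M {0, 1} T
        else M S T) →
    (∀ (M : Matrix (Finset (Fin (k + 3))) (Finset (Fin (k + 3))) (MvPolynomial (Fin (k + 3) × Fin (k + 3)) ℂ))
        (S T : Finset (Fin (k + 3))),
      (M * EQ) S T =
        if T = {1, 2} then M S {1, 2} - X (1, 0) * M S {0} + X (0, 0) * M S {1} - M S {0}
        else if T = {1} then -M S {1} + M S {0, 2}
        else if T.card = 1 then -M S T
        else M S T) →
    ∀ S T : Finset (Fin (k + 3)), S ≠ Finset.univ → S ≠ ∅ → S ≠ {0} → S ≠ {1} → T ≠ ∅ →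
      ((∃ v, (P * (1 - Grenet.adj ℂ (k + 3)) * EQ) S T = -X v) ∨
        ∃ c, (P * (1 - Grenet.adj ℂ (k + 3)) * EQ) S T = C c) ∧
      MvPolynomial.coeff (Finsupp.single ((0 : Fin (k + 3)), (0 : Fin (k + 3))) 1)
          ((P * (1 - Grenet.adj ℂ (k + 3)) * EQ) S T) = 0 := by
  intro k P EQ hP hEQ S T _ hSe hS0 hS1 _
  set A := Grenet.adj ℂ (k + 3) with hA
  -- `0, 1, 2` are distinct in `Fin (k + 3)` (their values are `0, 1, 2` by `rfl`)
  have h01 : (0 : Fin (k + 3)) ≠ 1 := Fin.ne_of_val_ne (show (0 : ℕ) ≠ 1 by decide)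
  have h02 : (0 : Fin (k + 3)) ≠ 2 := Fin.ne_of_val_ne (show (0 : ℕ) ≠ 2 by decide)
  have h12 : (1 : Fin (k + 3)) ≠ 2 := Fin.ne_of_val_ne (show (1 : ℕ) ≠ 2 by decide)
  have c01 : ({0, 1} : Finset (Fin (k + 3))).card = 2 := Finset.card_pair h01
  have c02 : ({0, 2} : Finset (Fin (k + 3))).card = 2 := Finset.card_pair h02
  have c12 : ({1, 2} : Finset (Fin (k + 3))).card = 2 := Finset.card_pair h12
  have n_1_12 : ({1} : Finset (Fin (k + 3))) ≠ {1, 2} :=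
    ne_of_apply_ne Finset.card (by rw [Finset.card_singleton, c12]; decide)
  have hSc : S.card ≠ 0 := fun h => hSe (Finset.card_eq_zero.mp h)
  -- the column action of `EQ`, by cases on the column
  have hE12 : ∀ (M : Matrix (Finset (Fin (k + 3))) (Finset (Fin (k + 3)))
      (MvPolynomial (Fin (k + 3) × Fin (k + 3)) ℂ)) (S' : Finset (Fin (k + 3))),
      (M * EQ) S' {1, 2} = M S' {1, 2} - X (1, 0) * M S' {0} + X (0, 0) * M S' {1} - M S' {0} :=
    fun M S' => by rw [hEQ, if_pos rfl]
  have hE1 : ∀ (M : Matrix (Finset (Fin (k + 3))) (Finset (Fin (k + 3)))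
      (MvPolynomial (Fin (k + 3) × Fin (k + 3)) ℂ)) (S' : Finset (Fin (k + 3))),
      (M * EQ) S' {1} = -M S' {1} + M S' {0, 2} :=
    fun M S' => by rw [hEQ, if_neg n_1_12, if_pos rfl]
  have hEs : ∀ (M : Matrix (Finset (Fin (k + 3))) (Finset (Fin (k + 3)))
      (MvPolynomial (Fin (k + 3) × Fin (k + 3)) ℂ)) (S' T' : Finset (Fin (k + 3))),
      T' ≠ {1, 2} → T' ≠ {1} → T'.card = 1 → (M * EQ) S' T' = -M S' T' :=
    fun M S' T' h1 h2 h3 => by rw [hEQ, if_neg h1, if_neg h2, if_pos h3]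
  have hEg : ∀ (M : Matrix (Finset (Fin (k + 3))) (Finset (Fin (k + 3)))
      (MvPolynomial (Fin (k + 3) × Fin (k + 3)) ℂ)) (S' T' : Finset (Fin (k + 3))),
      T' ≠ {1, 2} → T' ≠ {1} → T'.card ≠ 1 → (M * EQ) S' T' = M S' T' :=
    fun M S' T' h1 h2 h3 => by rw [hEQ, if_neg h1, if_neg h2, if_neg h3]
  by_cases hc : S.card = 1
  · /- the singleton rows `S = {l}`, `l ≥ 2`: the row of `P · (1 − adj)` is the sum of the rows
      `{l}` and `{0, 1}` of `1 − adj` -/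
    obtain ⟨l, rfl⟩ := Finset.card_eq_one.mp hc
    have hl0 : l ≠ 0 := fun h => hS0 (by rw [h])
    have hl1 : l ≠ 1 := fun h => hS1 (by rw [h])
    have hPF : ∀ T', (P * (1 - A)) {l} T' = (1 - A) {l} T' + (1 - A) {0, 1} T' := fun T' => by
      rw [hP, if_neg hSe, if_neg hS0, if_neg hS1, if_pos hc]
    have n01e : ({0, 1} : Finset (Fin (k + 3))) ≠ ∅ := Finset.insert_ne_empty 0 {1}
    -- the cells of the two rows in the columns `{0}`, `{1}`, `{1,2}`, `{0,2}`
    have F_l_0 : (1 - A) {l} {0} = 0 :=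
      one_sub_adj_apply_of_card_ne hS0 (by rw [Finset.card_singleton, hc]; decide)
    have F_l_1 : (1 - A) {l} {1} = 0 :=
      one_sub_adj_apply_of_card_ne hS1 (by rw [Finset.card_singleton, hc]; decide)
    have F_01_0 : (1 - A) {0, 1} {0} = 0 :=
      one_sub_adj_apply_of_card_ne (ne_of_apply_ne Finset.card (by
        rw [c01, Finset.card_singleton]; decide)) (by rw [Finset.card_singleton, c01]; decide)
    have F_01_1 : (1 - A) {0, 1} {1} = 0 :=
      one_sub_adj_apply_of_card_ne (ne_of_apply_ne Finset.card (by
        rw [c01, Finset.card_singleton]; decide)) (by rw [Finset.card_singleton, c01]; decide)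
    have F_01_12 : (1 - A) {0, 1} {1, 2} = 0 :=
      one_sub_adj_apply_of_card_ne (ne_of_mem_of_not_mem' (a := 0) (by simp) (by simp [h01, h02]))
        (by rw [c12, c01]; decide)
    have F_01_02 : (1 - A) {0, 1} {0, 2} = 0 :=
      one_sub_adj_apply_of_card_ne (ne_of_mem_of_not_mem' (a := 1) (by simp) (by simp [h01.symm, h12]))
        (by rw [c02, c01]; decide)
    have F_l_12 : (1 - A) {l} {1, 2} = -A {l} {1, 2} :=
      one_sub_adj_apply_of_ne (ne_of_apply_ne Finset.card (by rw [hc, c12]; decide))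
    have F_l_02 : (1 - A) {l} {0, 2} = -A {l} {0, 2} :=
      one_sub_adj_apply_of_ne (ne_of_apply_ne Finset.card (by rw [hc, c02]; decide))
    by_cases hT12 : T = {1, 2}
    · -- column `{1, 2}`: the cell is `−adj {l} {1,2}` (`−X (1,1)` for `l = 2`, else `0`)
      subst hT12
      refine isPure_and_coeff_zero_of_eq_neg_adj {1, 2} hSe ?_
      rw [hE12, hPF, hPF, hPF, F_l_0, F_l_1, F_01_0, F_01_1, F_01_12, F_l_12]
      ring
    by_cases hT1 : T = {1}
    · -- column `{1}`: the cell is `−adj {l} {0,2}` (`−X (0,1)` for `l = 2`, else `0`)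
      subst hT1
      refine isPure_and_coeff_zero_of_eq_neg_adj {0, 2} hSe ?_
      rw [hE1, hPF, hPF, F_l_1, F_01_1, F_01_02, F_l_02]
      ring
    by_cases hTc : T.card = 1
    · -- the other singleton columns: the cell is `−[T = {l}]`
      have F_01_T : (1 - A) {0, 1} T = 0 :=
        one_sub_adj_apply_of_card_ne (ne_of_apply_ne Finset.card (by rw [c01, hTc]; decide))
          (by rw [hTc, c01]; decide)
      by_cases hlT : ({l} : Finset (Fin (k + 3))) = T
      · subst hlT
        refine isPure_and_coeff_zero_of_eq_C (-1) ?_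
        rw [hEs _ _ _ hT12 hT1 hTc, hPF, F_01_T, one_sub_adj_apply_self, add_zero, map_neg, map_one]
      · refine isPure_and_coeff_zero_of_eq_C 0 ?_
        rw [hEs _ _ _ hT12 hT1 hTc, hPF, F_01_T, one_sub_adj_apply_of_card_ne hlT (by rw [hTc, hc]; decide),
          add_zero, neg_zero, map_zero]
    -- the generic columns (`|T| ≠ 1`, `T ≠ {1,2}`): the cell is `(1 − adj) {l} T + (1 − adj) {0,1} T`
    have hlT : ({l} : Finset (Fin (k + 3))) ≠ T := fun h => hTc (by rw [← h, hc])
    by_cases hT01 : T = {0, 1}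
    · -- column `{0,1}`: the cell is `1`
      subst hT01
      refine isPure_and_coeff_zero_of_eq_C 1 ?_
      have F_l_01 : (1 - A) {l} {0, 1} = 0 := by
        rw [one_sub_adj_apply_of_ne hlT, neg_eq_zero]
        exact Grenet.adj_apply_of_mem_of_notMem ℂ (Finset.mem_singleton_self l) (by simp [hl0, hl1])
      rw [hEg _ _ _ hT12 hT1 hTc, hPF, F_l_01, one_sub_adj_apply_self, zero_add, map_one]
    by_cases hT2 : T.card = 2
    · -- the other columns of cardinality `2`: the cell is `−adj {l} T`
      refine isPure_and_coeff_zero_of_eq_neg_adj T hSe ?_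
      rw [hEg _ _ _ hT12 hT1 hTc, hPF, one_sub_adj_apply_of_ne hlT,
        one_sub_adj_apply_of_card_ne (Ne.symm hT01) (by rw [hT2, c01]; decide), add_zero]
    · -- the columns of cardinality `≥ 3`: the cell is `−adj {0,1} T`
      refine isPure_and_coeff_zero_of_eq_neg_adj T n01e ?_
      rw [hEg _ _ _ hT12 hT1 hTc, hPF, one_sub_adj_apply_of_card_ne hlT (by rw [hc]; exact hT2),
        one_sub_adj_apply_of_ne (Ne.symm hT01), zero_add]
  · /- the rows with `|S| ≥ 2`: the row of `P · (1 − adj)` is the row `S` of `1 − adj` -/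
    have hPF : ∀ T', (P * (1 - A)) S T' = (1 - A) S T' := fun T' => by
      rw [hP, if_neg hSe, if_neg hS0, if_neg hS1, if_neg hc]
    have F_S_0 : (1 - A) S {0} = 0 :=
      one_sub_adj_apply_of_card_ne hS0 (by rw [Finset.card_singleton]; omega)
    have F_S_1 : (1 - A) S {1} = 0 :=
      one_sub_adj_apply_of_card_ne hS1 (by rw [Finset.card_singleton]; omega)
    by_cases hT12 : T = {1, 2}
    · -- column `{1, 2}`: the cell is `[S = {1,2}]`
      subst hT12
      refine isPure_and_coeff_zero_of_eq_C (if S = {1, 2} then 1 else 0) ?_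
      rw [hE12, hPF, hPF, hPF, F_S_0, F_S_1, Grenet.one_sub_adj_apply,
        Grenet.adj_apply_of_card_ne ℂ (by rw [c12]; omega)]
      split_ifs <;> simp
    by_cases hT1 : T = {1}
    · -- column `{1}`: the cell is `[S = {0,2}]`
      subst hT1
      refine isPure_and_coeff_zero_of_eq_C (if S = {0, 2} then 1 else 0) ?_
      rw [hE1, hPF, hPF, F_S_1, Grenet.one_sub_adj_apply,
        Grenet.adj_apply_of_card_ne ℂ (by rw [c02]; omega)]
      split_ifs <;> simp
    by_cases hTc : T.card = 1
    · -- the other singleton columns: the cell is `0`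
      refine isPure_and_coeff_zero_of_eq_C 0 ?_
      have hST : S ≠ T := fun h => hc (by rw [h, hTc])
      rw [hEs _ _ _ hT12 hT1 hTc, hPF, one_sub_adj_apply_of_card_ne hST (by rw [hTc]; omega),
        neg_zero, map_zero]
    -- the generic columns: the cell is `(1 − adj) S T`
    by_cases hST : S = T
    · subst hST
      refine isPure_and_coeff_zero_of_eq_C 1 ?_
      rw [hEg _ _ _ hT12 hT1 hTc, hPF, one_sub_adj_apply_self, map_one]
    · refine isPure_and_coeff_zero_of_eq_neg_adj T hSe ?_
      rw [hEg _ _ _ hT12 hT1 hTc, hPF, one_sub_adj_apply_of_ne hST]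

end

end Summit.ValiantsHypothesis.ValiantsHypothesis.Theorems.ProjectionStabilityUniqStep
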